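import Literature.LinearAlgebra.Matrix.UnitarySimilarityPositiveWords
import Literature.LinearAlgebra.Matrix.OrthogonalSimultaneousSimilarity
import HarnessLib

/-!
# [Sengupta1994] Theorem 2 for PRODUCTS of the listed groups and for ABELIAN factors — the two reduction sentences
# of its proof, and the theorem as printed for every (finite or infinite) product of listed groups

statement-level skeleton of published theorems with citation tags; proofs where landed; nothing here is a claim about
the Yang–Mills mass gap

[Sengupta1994] Theorem 2 (p.900) reads: «Let G be a product of groups from the following list: abelian groups, the
unitary groups U(n), special unitary groups SU(n), orthogonal groups O(n), and the odd special orthogonal groups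
SO(2n+1). Suppose that {g_a}_{a∈I} and {g'_a}_{a∈I} are families of elements of G such that for every a₁, …, a_k ∈ I
the product g_{a₁}⋯g_{a_k} is conjugate in G to g'_{a₁}⋯g'_{a_k}. Then there is an element y ∈ G such that g'_a =
y g_a y⁻¹ for every a ∈ I.»  Its proof opens (p.900): «If G is abelian then the result is trivial. Moreover, if the
result holds for each member of a family of groups then it does for their product. Therefore, it will suffice to
consider the cases where G is one of the groups U(n), SU(n), O(n), or SO(2n+1).»

The four matrix cases are tree theorems (`unitaryGroup_exists_conj_of_prod_conj`,
`specialUnitaryGroup_exists_conj_of_prod_conj` in `UnitarySimilarityPositiveWords`;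
`orthogonalGroup_exists_conj_of_prod_conj`, `specialOrthogonalGroup_exists_conj_of_prod_conj` in
`OrthogonalSimultaneousSimilarity`).  This file supplies the two reduction sentences and assembles the theorem AS
PRINTED: the conclusion of Theorem 2 is packaged as a property `ProdConjDetermined G` of a group `G` (§1); it holds for
every commutative group (`ProdConjDetermined.of_commGroup`, «trivial»: one-letter products), is inherited by binary
products (`ProdConjDetermined.prod`) and by arbitrary — not only finite — products (`ProdConjDetermined.pi`: the
hypothesis projects to each factor, evaluation at `j` being a homomorphism, and the factorwise conjugators assemble
by the axiom of choice), and holds for `U(n)`, `SU(n)`, `O(n)`, `SO(n)` with `n` odd (§3, by name).  §4 states the theorem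
for a product `Π_j G_j` of listed groups (`pi_exists_conj_of_prod_conj`) and the Mathlib-`IsConj` phrasing.

HONEST SCOPE. Nothing beyond the printed sentences: the even special orthogonal groups `SO(2n)`, `n ≥ 2`, and the
symplectic groups are NOT on Sengupta's list and are not treated (`SO(2)` is abelian, hence covered by
`ProdConjDetermined.of_commGroup`); a "product of groups from the list" is rendered as a `Π`-type (or `×`) of
groups each satisfying `ProdConjDetermined`, which is exactly what the two reduction sentences deliver.  Index sets
are arbitrary types in a universe fixed by the property (`ProdConjDetermined.{u, v}`: groups in `Type u`, index types
in `Type v`).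

References: [Sengupta1994] A. Sengupta, Gauge invariant functions of connections, Proc. Amer. Math. Soc. 121 (1994)
897–905, Theorem 2 p.900 and the first lines of its proof.  Mathlib: `isConj_iff`, `Matrix.unitaryGroup`,
`Matrix.specialUnitaryGroup`, `Matrix.orthogonalGroup`, `Matrix.specialOrthogonalGroup`.
-/

namespace Literature.LinearAlgebra.Matrix

universe u v w u₁ u₂

section Property

/-- **The conclusion of [Sengupta1994] Theorem 2 as a property of the group `G`:** for every index type `ι` and all
families `V W : ι → G`, if every NON-EMPTY positive product `W_{a₁}⋯W_{a_k}` is conjugate in `G` to `V_{a₁}⋯V_{a_k}`,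
then `W_a = y V_a y⁻¹` for ONE `y ∈ G` and every `a`.  (Universe `v` of the index types is a parameter of the
property.) [cite: Sengupta1994, Thm 2 p.900] -/
def ProdConjDetermined (G : Type u) [Group G] : Prop :=
  ∀ ⦃ι : Type v⦄ (V W : ι → G),
    (∀ l : List ι, l ≠ [] → ∃ y : G, (l.map W).prod = y * (l.map V).prod * y⁻¹) →
      ∃ y : G, ∀ i, W i = y * V i * y⁻¹

/-- Unfolding lemma. [cite: Sengupta1994, Thm 2 p.900] -/
theorem prodConjDetermined_iff (G : Type u) [Group G] :
    ProdConjDetermined.{u, v} G ↔ ∀ ⦃ι : Type v⦄ (V W : ι → G),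
      (∀ l : List ι, l ≠ [] → ∃ y : G, (l.map W).prod = y * (l.map V).prod * y⁻¹) →
        ∃ y : G, ∀ i, W i = y * V i * y⁻¹ :=
  Iff.rfl

end Property

/-! ## §2 The two reduction sentences of the proof (p.900) -/

section Reductions

/-- Components of a list product in `G × H`. [folklore] -/
private theorem fst_list_prod {G : Type u₁} {H : Type u₂} [Monoid G] [Monoid H] {ι : Type v} (f : ι → G × H)
    (l : List ι) : ((l.map f).prod).1 = (l.map fun i => (f i).1).prod := by
  induction l with
  | nil => rfl
  | cons a l ih => simp only [List.map_cons, List.prod_cons, Prod.fst_mul, ih]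

/-- Components of a list product in `G × H`. [folklore] -/
private theorem snd_list_prod {G : Type u₁} {H : Type u₂} [Monoid G] [Monoid H] {ι : Type v} (f : ι → G × H)
    (l : List ι) : ((l.map f).prod).2 = (l.map fun i => (f i).2).prod := by
  induction l with
  | nil => rfl
  | cons a l ih => simp only [List.map_cons, List.prod_cons, Prod.snd_mul, ih]

/-- Components of a list product in `Π_j G_j`. [folklore] -/
private theorem pi_list_prod_apply {J : Type w} {G : J → Type u} [∀ j, Monoid (G j)] {ι : Type v}
    (f : ι → ∀ j, G j) (l : List ι) (j : J) : ((l.map f).prod) j = (l.map fun i => f i j).prod := by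
  induction l with
  | nil => rfl
  | cons a l ih => simp only [List.map_cons, List.prod_cons, Pi.mul_apply, ih]

/-- A conjugate of a product is the product of the conjugates. [folklore] -/
private theorem prod_map_conj {G : Type u} [Group G] {ι : Type v} (y : G) (g : ι → G) (l : List ι) :
    (l.map fun a => y * g a * y⁻¹).prod = y * (l.map g).prod * y⁻¹ := by
  induction l with
  | nil => simp
  | cons a l ih =>
      simp only [List.map_cons, List.prod_cons, ih]
      group

/-- «If G is abelian then the result is trivial» ([Sengupta1994] p.900): in a commutative group conjugate elements are
equal, so the one-letter products already give `W_a = V_a = 1·V_a·1⁻¹`. [cite: Sengupta1994, proof of Thm 2 p.900] -/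
theorem ProdConjDetermined.of_commGroup (G : Type u) [CommGroup G] : ProdConjDetermined.{u, v} G := by
  intro ι V W h
  refine ⟨1, fun i => ?_⟩
  obtain ⟨y, hy⟩ := h [i] (List.cons_ne_nil i [])
  simp only [List.map_cons, List.map_nil, List.prod_cons, List.prod_nil, mul_one] at hy
  rw [hy, one_mul, inv_one, mul_one, mul_comm y, mul_assoc, mul_inv_cancel, mul_one]

/-- «if the result holds for each member of a family of groups then it does for their product» ([Sengupta1994]
p.900), BINARY form: conjugacy of the products in `G × H` projects to conjugacy in `G` and in `H` (first and second
components of the products), and the two conjugators pair up. [cite: Sengupta1994, proof of Thm 2 p.900] -/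
theorem ProdConjDetermined.prod {G : Type u₁} {H : Type u₂} [Group G] [Group H]
    (hG : ProdConjDetermined.{u₁, v} G) (hH : ProdConjDetermined.{u₂, v} H) :
    ProdConjDetermined.{max u₁ u₂, v} (G × H) := by
  intro ι V W h
  have h1 : ∀ l : List ι, l ≠ [] →
      ∃ y : G, (l.map fun i => (W i).1).prod = y * (l.map fun i => (V i).1).prod * y⁻¹ := by
    intro l hl
    obtain ⟨y, hy⟩ := h l hl
    refine ⟨y.1, ?_⟩
    rw [← fst_list_prod W, ← fst_list_prod V, hy, Prod.fst_mul, Prod.fst_mul, Prod.fst_inv]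
  have h2 : ∀ l : List ι, l ≠ [] →
      ∃ y : H, (l.map fun i => (W i).2).prod = y * (l.map fun i => (V i).2).prod * y⁻¹ := by
    intro l hl
    obtain ⟨y, hy⟩ := h l hl
    refine ⟨y.2, ?_⟩
    rw [← snd_list_prod W, ← snd_list_prod V, hy, Prod.snd_mul, Prod.snd_mul, Prod.snd_inv]
  obtain ⟨y₁, hy₁⟩ := hG (fun i => (V i).1) (fun i => (W i).1) h1
  obtain ⟨y₂, hy₂⟩ := hH (fun i => (V i).2) (fun i => (W i).2) h2
  exact ⟨(y₁, y₂), fun i => Prod.ext (hy₁ i) (hy₂ i)⟩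

/-- «if the result holds for each member of a family of groups then it does for their product» ([Sengupta1994]
p.900), for an ARBITRARY family `(G_j)_{j ∈ J}` (finite or not): conjugacy of the products in `Π_j G_j` projects to
each factor (evaluation at `j` is a homomorphism), and the factorwise conjugators `y_j` assemble to `y = (y_j)_j`
(axiom of choice when `J` is infinite).
[cite: Sengupta1994, proof of Thm 2 p.900] -/
theorem ProdConjDetermined.pi {J : Type w} {G : J → Type u} [∀ j, Group (G j)]
    (hG : ∀ j, ProdConjDetermined.{u, v} (G j)) : ProdConjDetermined.{max w u, v} (∀ j, G j) := by
  intro ι V W h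
  have hj : ∀ j, ∃ y : G j, ∀ i, W i j = y * V i j * y⁻¹ := by
    intro j
    refine hG j (fun i => V i j) (fun i => W i j) fun l hl => ?_
    obtain ⟨y, hy⟩ := h l hl
    refine ⟨y j, ?_⟩
    rw [← pi_list_prod_apply W, ← pi_list_prod_apply V, hy, Pi.mul_apply, Pi.mul_apply, Pi.inv_apply]
  choose y hy using hj
  exact ⟨fun j => y j, fun i => funext fun j => by simp [hy j i, Pi.mul_apply, Pi.inv_apply]⟩

end Reductions

/-! ## §3 The four matrix groups of the list (tree theorems, by name) -/

section Listed

variable (n : Type) [Fintype n] [DecidableEq n]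

/-- `G = U(n)` has the property ([Sengupta1994] Thm 2 for `U(n)`, tree theorem
`unitaryGroup_exists_conj_of_prod_conj`). [cite: Sengupta1994, Thm 2 p.900] -/
theorem prodConjDetermined_unitaryGroup : ProdConjDetermined.{0, v} (Matrix.unitaryGroup n ℂ) :=
  fun _ V W h => unitaryGroup_exists_conj_of_prod_conj V W h

/-- `G = SU(n)` has the property ([Sengupta1994] Thm 2 for `SU(n)`, tree theorem
`specialUnitaryGroup_exists_conj_of_prod_conj`). [cite: Sengupta1994, Thm 2 pp.900–901] -/
theorem prodConjDetermined_specialUnitaryGroup : ProdConjDetermined.{0, v} (Matrix.specialUnitaryGroup n ℂ) :=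
  fun _ V W h => specialUnitaryGroup_exists_conj_of_prod_conj V W h

/-- `G = O(n)` has the property ([Sengupta1994] Thm 2 for `O(n)`, tree theorem
`orthogonalGroup_exists_conj_of_prod_conj`). [cite: Sengupta1994, Thm 2 p.900] -/
theorem prodConjDetermined_orthogonalGroup : ProdConjDetermined.{0, v} (Matrix.orthogonalGroup n ℝ) :=
  fun _ V W h => orthogonalGroup_exists_conj_of_prod_conj V W h

/-- `G = SO(2m+1)` (odd special orthogonal groups) has the property ([Sengupta1994] Thm 2 for `SO(2n+1)`, tree theorem
`specialOrthogonalGroup_exists_conj_of_prod_conj`). [cite: Sengupta1994, Thm 2 p.900] -/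
theorem prodConjDetermined_specialOrthogonalGroup (hn : Odd (Fintype.card n)) :
    ProdConjDetermined.{0, v} (Matrix.specialOrthogonalGroup n ℝ) :=
  fun _ V W h => specialOrthogonalGroup_exists_conj_of_prod_conj hn V W h

end Listed

/-! ## §4 Theorem 2 as printed: products of listed groups; the `IsConj` phrasing -/

section Printed

/-- **[Sengupta1994] THEOREM 2 FOR A PRODUCT OF GROUPS.**  Let `G = Π_{j ∈ J} G_j` where every factor `G_j` is a
group for which the conclusion of Theorem 2 holds — in particular (§2–§3) any abelian group, `U(n)`, `SU(n)`, `O(n)`,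
`SO(2n+1)`, or again a product of such.  If `{g_a}_{a ∈ I}`, `{g'_a}_{a ∈ I} ⊂ G` are families such that every
non-empty product `g_{a₁}⋯g_{a_k}` is conjugate in `G` to `g'_{a₁}⋯g'_{a_k}`, then there is `y ∈ G` with
`g'_a = y g_a y⁻¹` for every `a ∈ I`. [cite: Sengupta1994, Thm 2 p.900] -/
theorem pi_exists_conj_of_prod_conj {J : Type w} {G : J → Type u} [∀ j, Group (G j)]
    (hG : ∀ j, ProdConjDetermined.{u, v} (G j)) {ι : Type v} (g g' : ι → ∀ j, G j)
    (h : ∀ l : List ι, l ≠ [] → ∃ y : ∀ j, G j, (l.map g').prod = y * (l.map g).prod * y⁻¹) :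
    ∃ y : ∀ j, G j, ∀ a, g' a = y * g a * y⁻¹ :=
  ProdConjDetermined.pi hG g g' h

/-- The hypothesis of Theorem 2 in Mathlib's vocabulary: «g_{a₁}⋯g_{a_k} is conjugate in G to g'_{a₁}⋯g'_{a_k}» is
`IsConj (l.map g).prod (l.map g').prod` (`isConj_iff`: `∃ c, c * a * c⁻¹ = b`). [cite: Sengupta1994, Thm 2 p.900] -/
theorem ProdConjDetermined.exists_conj_of_isConj {G : Type u} [Group G] (hG : ProdConjDetermined.{u, v} G)
    {ι : Type v} (g g' : ι → G) (h : ∀ l : List ι, l ≠ [] → IsConj (l.map g).prod (l.map g').prod) :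
    ∃ y : G, ∀ a, g' a = y * g a * y⁻¹ :=
  hG g g' fun l hl => by
    obtain ⟨c, hc⟩ := isConj_iff.mp (h l hl)
    exact ⟨c, hc.symm⟩

/-- Conversely the conclusion gives back conjugacy of ALL products (also the empty one), so for a group with the
property the two are EQUIVALENT. [cite: Sengupta1994, Thm 2 p.900] -/
theorem ProdConjDetermined.isConj_prod_iff {G : Type u} [Group G] (hG : ProdConjDetermined.{u, v} G)
    {ι : Type v} (g g' : ι → G) :
    (∀ l : List ι, l ≠ [] → IsConj (l.map g).prod (l.map g').prod) ↔ ∃ y : G, ∀ a, g' a = y * g a * y⁻¹ := by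
  refine ⟨hG.exists_conj_of_isConj g g', fun ⟨y, hy⟩ l _ => isConj_iff.mpr ⟨y, ?_⟩⟩
  have hmap : l.map g' = l.map (fun a => y * g a * y⁻¹) := List.map_congr_left fun a _ => hy a
  rw [hmap, prod_map_conj]

/-- A concrete product from the list, for illustration: `U(1)^J × (SU(N_j))_j`-type gauge groups — here any product
`Π_j SU(N_j)` of special unitary groups. [cite: Sengupta1994, Thm 2 p.900] -/
theorem prodConjDetermined_pi_specialUnitaryGroup {J : Type w} (N : J → ℕ) :
    ProdConjDetermined.{w, v} (∀ j, Matrix.specialUnitaryGroup (Fin (N j)) ℂ) :=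
  ProdConjDetermined.pi fun j => prodConjDetermined_specialUnitaryGroup (Fin (N j))

/-- … and a mixed binary product `U(m) × SO(n)`, `n` odd. [cite: Sengupta1994, Thm 2 p.900] -/
theorem prodConjDetermined_unitaryGroup_prod_specialOrthogonalGroup (m n : Type) [Fintype m] [DecidableEq m]
    [Fintype n] [DecidableEq n] (hn : Odd (Fintype.card n)) :
    ProdConjDetermined.{0, v} (Matrix.unitaryGroup m ℂ × Matrix.specialOrthogonalGroup n ℝ) :=
  (prodConjDetermined_unitaryGroup m).prod (prodConjDetermined_specialOrthogonalGroup n hn)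

end Printed

end Literature.LinearAlgebra.Matrix
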